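import Summits.BirchSwinnertonDyer.BirchSwinnertonDyer.Theses.MordellShaFreeCut
import Summits.BirchSwinnertonDyer.BirchSwinnertonDyer.Theorems.MordellShaFreeCutKatoZetaRoadLogZeroH2
import Literature.NumberTheory.EllipticCurves.Kato2004.IwasawaH1RankLowerBound

set_option linter.dupNamespace false

/-! # BC3 skeleton **READY v1i** — crux `AnalyticRankOneOfRankOneFiniteShaThree` (route `MordellShaFreeCut`, rung S2b;
stmt-BirchSwinnertonDyer-19160), line `kato-zeta-perrin-riou` **v1i = v1h with the RESEARCH stub re-cut to the NAMED annihilation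
half `stub_logZeroAtThree : LogZeroAtThreeH2`** (plan g22 RULING-1, STATUS 2026-08-27T11:53:48Z: «v1i ADOPTED IN DESIGN» with the
NAMED-DEF condition (3); WAKE-plan-g22-v1i.md deliverable (2)). Written by the prover seat `bsd-cn100-s2b-c3` g23 (2026-08-27) from the
g22 CANDIDATE (778ae2189fae4732…) by exactly two changes: the import of the def module `Theorems/MordellShaFreeCutKatoZetaRoadLogZeroH2.lean`
(p531973: `@[conjecture] def LogZeroAtThreeH2 := (V₃)`, body token-identical to the `hV` binder of p528124 §4, squeezed sha16 fa99cddb07136e1f)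
and the research stub's TYPE, now the def BY NAME. `stub_refereedInputs` is TOKEN-IDENTICAL with the registered v1h (RI7′, normalised-binder
sha16 ce8f9717f35ddfd4); `nontrivialH1` / `readingRK` / `reading31` / `reading31AtPin` / `reading31b` TOKEN-IDENTICAL with v1h; the composition
`_of_stubs` is the candidate's readings composition `MordellShaFreeCutKatoZetaRoadLogZero.cruxB_of_logZero_of_readingsAtPin` (p528124 §3) with
`hV := stub_logZeroAtThree` (the def unfolds by `δ`); equivalent one-liner BY NAME:
`MordellShaFreeCutKatoZetaRoadLogZeroH2.cruxB_of_registeredRI7prime_of_logZeroH2 stub_refereedInputs stub_logZeroAtThree`.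
REGISTRY: this file registers nothing — the act v1h → v1i (xvii) is the PLAN's after re-executing this body and the probe battery
`S2b_katozeta_v1i_stub_probes.lean` on the farm (RULING-1 (2)(i)–(vi); ROLLBACK clause (vi)).

ACT TESTS (3c): (i) MONOTONE BY NAME — `MordellShaFreeCutKatoZetaRoadLogZeroH2.logZeroH2_of_prFormulaH2 : PRFormulaAtThreeH2 → LogZeroAtThreeH2`;
(ii) SUFFICIENT BY NAME — `…LogZeroH2.cruxB_of_registeredRI7prime_of_logZeroH2` and THIS body: rc 0, sorries EXACTLY 2 = {`stub_refereedInputs`,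
`stub_logZeroAtThree`}, `_of_stubs` concludes the crux BY NAME, no placeholder, no local def; (iii) RI UNTOUCHED; (iv) STRICTNESS — probe Q4
`LogZeroAtThreeH2 → PRFormulaAtThreeH2` must not close; (v) probes Q1–Q6. PRINT SHAPE of the research stub: the (⟹) half of Perrin-Riou 1993
Conj. 3.3.2 / Formule 3.3.4 in the local Kummer currency = Burungale–Skinner–Tian–Wan Conj. 1.12 (a)+(b) at `ord ≠ 1` = Bertolini–Darmon–Venerucci
Thm. A at a torsion `P`; OPEN at the additive prime 3 (0 sources; LIT-G18 §1) exactly like `PRFormulaAtThreeH2` — the re-cut buys an honest,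
smaller research input (no `c ≠ 0`, no `ι : K → ℚ₃`), NOT provability.

THE LINE: crux B ⟸ seven citation-borne facts (RI7′) + tree theorems [(α) p510488, tf p491527, pin, `locP_kernel_isTorsion_of_rankOne_holds`
p484260, (R1) p508547, (R2) p514042] + ONE research statement `LogZeroAtThreeH2`.
HONESTY: nothing about BSD, the leaf `rankOne_threeConverse_mordellCurve`, Sylvester's problem or crux B is proved here. PARTITION: none (RANK axis). -/

noncomputable section

open scoped Classical

namespace Summit.BirchSwinnertonDyer.BirchSwinnertonDyer.Cruxes.AnalyticRankOneOfRankOneFiniteShaThree.KatoZetaPerrinRiou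

open WeierstrassCurve NumberField IsDedekindDomain Field Literature.NumberTheory.EllipticCurves
  Literature.NumberTheory.EllipticCurves.ModularForms Literature.NumberTheory.EllipticCurves.Kato2004
  Literature.NumberTheory.EllipticCurves.Kato2004.EulerSystemValues
  Literature.NumberTheory.GaloisRepresentations
  Summit.BirchSwinnertonDyer.Rank1Residual.Additive
  Summit.BirchSwinnertonDyer.BirchSwinnertonDyer.Theses.MordellShaFreeCut
  Summit.BirchSwinnertonDyer.BirchSwinnertonDyer.Theorems.CongruentShaFreeCutKatoDescentDatumOfH2
  Summit.BirchSwinnertonDyer.BirchSwinnertonDyer.Theorems.MordellShaFreeCutKatoZetaRoadPinnedH2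
  Summit.BirchSwinnertonDyer.BirchSwinnertonDyer.Theorems.MordellShaFreeCutKatoZetaRoadPinnedH2AtPin
  Summit.BirchSwinnertonDyer.BirchSwinnertonDyer.Theorems.MordellShaFreeCutKatoZetaRoadNontrivialH1
  Summit.BirchSwinnertonDyer.BirchSwinnertonDyer.Theorems.CongruentShaFreeCutKatoReadingsOfNontrivialH1
  Summit.BirchSwinnertonDyer.BirchSwinnertonDyer.Theorems.MordellShaFreeCutKatoZetaRoadLogZero
  Summit.BirchSwinnertonDyer.BirchSwinnertonDyer.Theorems.MordellShaFreeCutKatoZetaRoadLogZeroH2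

/-- **stub_refereedInputs** (size S, CITATION-BORNE; v1h: SEVEN conjuncts = RI7′): the six refereed inputs (3-parity, modularity,
Hoffstein–Luo, Kato finiteness, Heegner points, Gross–Zagier + Kolyvagin) AND (NT) «`1 ≤ rank_Λ 𝐇¹_Γ(T_pW)` on every cyclotomic pin»
(Kato (12.2.2)'s consequence, the Literature def `Kato2004.one_le_rank_iwasawaH1`, p516793) in place of v1g's READING-grade
`Kato2004.thm12_4`.
[cite: DokchitserDokchitserAnnals2010, Thm. 1.4] [cite: Kato2004Asterisque, Cor. 14.3, §12.2 (12.2.2) (p. 220), §14.1]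
[cite: GrossZagier1986, Thm. I.6.3 with V.§2] [cite: Gross1984, §§3–4] -/
theorem stub_refereedInputs :
    (∀ (W : WeierstrassCurve ℚ) [W.IsElliptic] (p : ℕ) [Fact p.Prime], p_parity W p) ∧
    ModularForms.exists_isNewformOf ∧
    HoffsteinLuo1997_exists_twist_L_one_ne_zero ∧
    (∀ (W : WeierstrassCurve ℚ) [W.IsElliptic] (p : ℕ) [Fact p.Prime],
      kato_finite_of_L_one_ne_zero W p) ∧
    (∀ (W : WeierstrassCurve ℚ) (K : Type) [Field K] [NumberField K], exists_isHeegnerPoint W K) ∧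
    (∀ (W : WeierstrassCurve ℚ) (N : ℕ) [NeZero N] (K : Type) [Field K] [NumberField K],
      analyticRankEK_eq_one_iff_heegner_nonTorsion W N K) ∧
    one_le_rank_iwasawaH1 := by
  sorry

/-- **(NT) in the `Nontrivial` currency** from conjunct 7 («`𝐇¹_Γ(T_pW) ≠ 0` on every cyclotomic pin»), by this seat's
`MordellShaFreeCutKatoZetaRoadNontrivialH1.nontrivial_iwasawaH1_of_one_le_rank`. [cite: Kato2004Asterisque, §12.2 (12.2.2) (p. 220) and Thm. 12.4 (2) (p. 221)] -/
theorem nontrivialH1 :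
    ∀ (W : WeierstrassCurve ℚ) [W.IsElliptic] (p : ℕ) [Fact p.Prime]
      [ContinuousSMul ℤ_[p] (W.tateModule p)] (κ : ZpExtension ℚ p) (γ : absoluteGaloisGroup ℚ),
      κ.IsCyclotomic → κ.IsTopGenerator γ → ∀ I : IwasawaH1Data W p κ γ, Nontrivial I.H :=
  nontrivial_iwasawaH1_of_one_le_rank stub_refereedInputs.2.2.2.2.2.2

/-- **readingRK, AT THE PIN** — proved in-skeleton from conjunct 7 by s2-c3 g12's
`CongruentShaFreeCutKatoReadingsOfNontrivialH1.readingRK_jZero_three_of_nontrivial` (p515014) over the tree theorems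
`nonempty_iwasawaH1Data_holds`, (α) `nonempty_iwasawaH2Data_holds` / `module_finite_of_isCyclotomic` (p510488), `isTorsionFree`
(p491527), (R1) `rank_integralH1_layerZero_le_one` (p508547), (R2) `thm12_4_clauses_of_nontrivial_of_rank_integralH1_le_one` (p514042);
`z` chosen by char-ideal algebra (p469342). [cite: Kato2004Asterisque, Thm. 12.4 (2) (p. 221), §12.2 (12.2.2) (p. 220) and §14.14 (14.14.1) (p. 243)] -/
theorem readingRK :
    ∀ (W : WeierstrassCurve ℚ) [W.IsElliptic] [W.IsGloballyMinimal]
      [ContinuousSMul ℤ_[3] (W.tateModule 3)], W.j = 0 → W.mordellWeilRank = 1 →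
        Finite (AddCommGroup.primaryComponent W.sha 3) →
        ∃ D : KatoDescentDatum 3, Nonempty (KatoDescentDatumPinH2 W 3 D) ∧
          ∃ a b : ℕ,
            Ideal.span {((3 : ℕ) : IwasawaAlgebra 3) ^ a} * Module.charIdeal (IwasawaAlgebra 3) D.H2 =
              Ideal.span {((3 : ℕ) : IwasawaAlgebra 3) ^ b} *
                Module.charIdeal (IwasawaAlgebra 3) (D.H ⧸ (IwasawaAlgebra 3) ∙ D.z) :=
  readingRK_jZero_three_of_nontrivial nontrivialH1

/-- **reading31** — the former RI conjunct `finite_descentCokernel_of_rankOne` (Kato (14.9.3) + (14.14.1)–(14.14.2) READ in rank one)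
DERIVED in-skeleton from conjunct 7 by s2-c3 g12's `CongruentShaFreeCutKatoReadingsOfNontrivialH1.finite_descentCokernel_of_rankOne_of_nontrivial`
(p515014; (α), (12.2.1), tf, (R1) inside). [cite: Kato2004Asterisque, §14.9 (14.9.3) (p. 240), §14.14 (14.14.1)–(14.14.2) (p. 243)] -/
theorem reading31 : finite_descentCokernel_of_rankOne :=
  finite_descentCokernel_of_rankOne_of_nontrivial nontrivialH1

/-- **reading31 on the v2 pin at `p = 3`** (the `h31` slot of the at-the-pin composition): transport of `reading31` along the pin
(`finite_coinvariants_H2_of_rankOne_of_nonempty_pinH2`, p466996). [cite: Kato2004Asterisque, §14.14 (14.14.1)–(14.14.2) (p. 243)] -/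
theorem reading31AtPin :
    ∀ (W : WeierstrassCurve ℚ) [W.IsElliptic] [W.IsGloballyMinimal]
      [ContinuousSMul ℤ_[3] (W.tateModule 3)] (D : KatoDescentDatum 3), W.j = 0 →
        Nonempty (KatoDescentDatumPinH2 W 3 D) → W.mordellWeilRank = 1 →
          Finite (AddCommGroup.primaryComponent W.sha 3) →
            Finite (IwasawaAlgebra.coinvariants 3 D.H2) :=
  fun _ _ _ _ D _ hD hrank hsha ↦ finite_coinvariants_H2_of_rankOne_of_nonempty_pinH2 reading31 D hD hrank hsha

/-- **reading31b** — TOKEN-IDENTICAL with v1g: from the TREE THEOREM `Kato2004.locP_kernel_isTorsion_of_rankOne_holds` (p484260) by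
`CongruentShaFreeCutKatoReading31b.reading31b_three_of_fact`. [cite: AlpogeBhargavaShnidman2022, App. A §10.1.3 (p. 34)] [cite: Kato2004Asterisque, §14.9 (14.9.3) (p. 240)] -/
theorem reading31b :
    ∀ (W : WeierstrassCurve ℚ) [W.IsElliptic] [W.IsGloballyMinimal]
      [ContinuousSMul ℤ_[3] (W.tateModule 3)] (D : KatoDescentDatum 3)
      (pin : KatoDescentDatumPinH2 W 3 D), W.j = 0 → W.mordellWeilRank = 1 →
        Finite (AddCommGroup.primaryComponent W.sha 3) →
          (∀ m : ℕ, 3 ^ m • D.ι (Submodule.Quotient.mk D.z) ≠ 0) →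
            ∀ t : ℚ_[3], HasLocPKummerLog W 3 pin.katoClass t → t ≠ 0 :=
  Summit.BirchSwinnertonDyer.BirchSwinnertonDyer.Theorems.CongruentShaFreeCutKatoReading31b.reading31b_three_of_fact
    Literature.NumberTheory.EllipticCurves.Kato2004.locP_kernel_isTorsion_of_rankOne_holds

/-- **stub_logZeroAtThree** (XL, OPEN — THE research statement of the line, BY DEF NAME): `LogZeroAtThreeH2` = (V₃), the
ANNIHILATION HALF of Perrin-Riou's formula for Kato's zeta element of a `j = 0` curve at the additive prime `3` — at a TORSION Heegner
point (⟺ `ord_{s=1} L(W,s) ≥ 3` here) with `L(W,1) = 0`, every v2-pinned Kato descent datum with Kato's Main Conjecture in `Λ ⊗ ℚ₃`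
has `3`-adic Kummer logarithm `0` (`Theorems/MordellShaFreeCutKatoZetaRoadLogZeroH2.lean`, p531973). Implied by v1h's
`stub_prFormulaAtThree : PRFormulaAtThreeH2` (`MordellShaFreeCutKatoZetaRoadLogZeroH2.logZeroH2_of_prFormulaH2`); 0 sources at the
additive prime `3`. [cite: PerrinRiou1993AIF, §3.3, Conj. 3.3.2 (p. 976) and Formule 3.3.4 (pp. 976–977)]
[cite: BurungaleSkinnerTianWan2024, Conj. 1.12] [cite: BertoliniDarmonVenerucci2022, Thm. A (1)–(2) (shape)] -/
theorem stub_logZeroAtThree : LogZeroAtThreeH2 := by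
  sorry

/-- The skeleton composition: crux B by the landed at-the-pin census with the research input (V₃) BY DEF NAME,
`MordellShaFreeCutKatoZetaRoadLogZero.cruxB_of_logZero_of_readingsAtPin` (p528124 §3; six refereed facts = conjuncts 1–6; `hRK` :=
`readingRK`, `h31` := `reading31AtPin`, `h31b` := `reading31b`, all proved above; `hV` := `stub_logZeroAtThree : LogZeroAtThreeH2`,
unfolded by `δ`) — the only theorem of this file concluding the crux by name. (Equivalently, BY NAME:
`MordellShaFreeCutKatoZetaRoadLogZeroH2.cruxB_of_registeredRI7prime_of_logZeroH2 stub_refereedInputs stub_logZeroAtThree`.) -/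
theorem AnalyticRankOneOfRankOneFiniteShaThree_of_stubs : AnalyticRankOneOfRankOneFiniteShaThree :=
  cruxB_of_logZero_of_readingsAtPin stub_refereedInputs.1 stub_refereedInputs.2.1 stub_refereedInputs.2.2.1
    stub_refereedInputs.2.2.2.1 stub_refereedInputs.2.2.2.2.1 stub_refereedInputs.2.2.2.2.2.1
    readingRK reading31AtPin reading31b stub_logZeroAtThree

end Summit.BirchSwinnertonDyer.BirchSwinnertonDyer.Cruxes.AnalyticRankOneOfRankOneFiniteShaThree.KatoZetaPerrinRiou

end
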